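import Mathlib
import Summits.Ventures.PercRepro2.Defs
import Summits.Ventures.PercRepro2.Graph
import Summits.Ventures.PercRepro2.OneColourSwitch
import Summits.Ventures.PercRepro2.RegionHubSign
import Summits.Ventures.PercRepro2.SideSwitch
import Summits.Ventures.PercRepro2.SideSwitchClosed
import Summits.Ventures.PercRepro2.M9NoPocketDefs
import Summits.Ventures.PercRepro2.M9NoPocketWorld
import Summits.Ventures.PercRepro2.M9NoPocketWorldD
import Summits.Ventures.PercRepro2.M9NoPocketFibre
import Summits.Ventures.PercRepro2.M9GeneralDSplit
import Summits.Ventures.PercRepro2.M9GeneralDHD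
import Summits.Ventures.PercRepro2.M9SubcubeHarris
import Summits.Ventures.PercRepro2.M9ClusterFibreHarris
import Summits.Ventures.PercRepro2.M9LatticeHarris
import Summits.Ventures.PercRepro2.M9PocketUnitFibre
import Summits.Ventures.PercRepro2.M9PocketUnitFibreSum
import Summits.Ventures.PercRepro2.M9PocketPsi2
import Summits.Ventures.PercRepro2.M9PocketPsi2Sign
import Summits.Ventures.PercRepro2.M9PocketProdHarris
import Summits.Ventures.PercRepro2.M9PocketProdPoint
import Summits.Ventures.PercRepro2.M9PocketProdWorlds
import Summits.Ventures.PercRepro2.M9PocketProdMono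
import Summits.Ventures.PercRepro2.M9PocketProdHD
import Summits.Ventures.PercRepro2.M9PocketProdLink

/-!
# The hub–dead-end sum of a product fibre is non-positive (blind cell PercRepro2, p3 g39,
2026-08-29; `proofs/P3-POCKETRK.md` §8′ (ii)–(iv) and §10 (d): the free-block extension,
part 6)

For a skeleton `ρ` with switchable blocks `𝔉` (free, non-linking, not attached to the pocket
cluster, closed, disjoint) and free edges `R`, the sum over the product fibre of the `HD`
weight `σ_pq · σ_rs` is non-positive (`sum_prod_fibre_HD_nonpos`): `M9PocketProdHarris` with
`p ~_Y q` monotone (`conn_prod_mono`), the complement pairing (`conn_compl_prod_of_conn_compl`),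
the weight `H S = [W-defect at φ S] · σ_rs(ρ)` antitone (`wdefect_prod_anti`) and non-negative
(`σ_rs(ρ) ≥ 0`), and `σ_rs` constant on the fibre (`sigma_rs_prod_eq`).  This is the
product-lattice Harris of `proofs/P3-POCKETRK.md` §8′ in the kernel: the dead and dirty
`K`-points of a skeleton with free non-linking blocks, summed over the free sides and the free
edges, are non-positive.  Own work; std axioms.
-/

namespace Summit.Ventures.PercRepro2

namespace NoPocket

open Finset Classical OneColourSwitch SideSwitch

variable {V : Type*} {E : Type*} {ends : E → Sym2 V} {p q r s d : V} {ρ : Config E}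
  {𝔉 : Finset (Finset V)} {R : Finset E}

/-- **The hub–dead-end sum of a product fibre is non-positive.** -/
theorem sum_prod_fibre_HD_nonpos (hdr : d ≠ r) (hds : d ≠ s)
    (hrs : within ends ({r, s} : Set V) = ∅)
    (hT : ∀ e, ends e ≠ s(d, r) ∧ ends e ≠ s(d, s))
    (hsep : sep2 ends p q r s ρ) (hD : DOne ends r s d ρ) (hK : d ∈ K2 ends r s ρ)
    (hB : ∀ x ∈ M2 (endsD ends d) r s ρ, x = r ∨ x = s)
    (hR : ∀ e, e ∈ R ↔ e ∉ touches ends (cluster ends ρ d ∪ K2 (endsD ends d) r s ρ ∪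
      M2 (endsD ends d) r s ρ))
    (h𝔉K : ∀ C ∈ 𝔉, (↑C : Set V) ⊆ K2 (endsD ends d) r s ρ)
    (h𝔉r : ∀ C ∈ 𝔉, r ∉ C) (h𝔉s : ∀ C ∈ 𝔉, s ∉ C)
    (h𝔉cl : ∀ C ∈ 𝔉, ClosedIn (endsD ends d) (sided (endsD ends d) r s ρ) (↑C : Set V))
    (h𝔉d : ∀ C ∈ 𝔉, ∀ e y, y ∈ C → ends e ≠ s(d, y))
    (h𝔉pk : ∀ C ∈ 𝔉, ∀ e x y, ends e = s(x, y) → x ∈ C → y ∈ cluster ends ρ d →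
      y ∈ C ∨ y = r ∨ y = s)
    (hdisj : ∀ C ∈ 𝔉, ∀ C' ∈ 𝔉, C ≠ C' → Disjoint C C')
    (h𝔉nl : ∀ C ∈ 𝔉, (∀ e y, y ∈ C → ends e ≠ s(r, y)) ∨ (∀ e y, y ∈ C → ends e ≠ s(s, y))) :
    ∑ S : Finset ({C // C ∈ 𝔉} ⊕ {e // e ∈ R}),
      (if WDefect ends p q r s d (flipTouch (endsD ends d)
          {x : V | ∃ c : {C // C ∈ 𝔉}, Sum.inl c ∈ S ∧ x ∈ c.1}
          (fun e => if h : e ∈ R then decide (Sum.inr ⟨e, h⟩ ∈ S) else ρ e)) then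
        sigma ends (flipTouch (endsD ends d)
          {x : V | ∃ c : {C // C ∈ 𝔉}, Sum.inl c ∈ S ∧ x ∈ c.1}
          (fun e => if h : e ∈ R then decide (Sum.inr ⟨e, h⟩ ∈ S) else ρ e)) p q *
        sigma ends (flipTouch (endsD ends d)
          {x : V | ∃ c : {C // C ∈ 𝔉}, Sum.inl c ∈ S ∧ x ∈ c.1}
          (fun e => if h : e ∈ R then decide (Sum.inr ⟨e, h⟩ ∈ S) else ρ e)) r s
      else 0) ≤ 0 := by
  have hrs0 : 0 ≤ sigma ends ρ r s := sigma_rs_nonneg_of_noWside hdr hds hrs hT hB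
  set φ : Finset ({C // C ∈ 𝔉} ⊕ {e // e ∈ R}) → Config E := fun S => flipTouch (endsD ends d)
    {x : V | ∃ c : {C // C ∈ 𝔉}, Sum.inl c ∈ S ∧ x ∈ c.1}
    (fun e => if h : e ∈ R then decide (Sum.inr ⟨e, h⟩ ∈ S) else ρ e) with hφ
  set H : Finset ({C // C ∈ 𝔉} ⊕ {e // e ∈ R}) → ℤ := fun S =>
    if WDefect ends p q r s d (φ S) then sigma ends ρ r s else 0 with hH
  have hY : ∀ S T : Finset ({C // C ∈ 𝔉} ⊕ {e // e ∈ R}), S ⊆ T →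
      Conn ends (φ S) p q → Conn ends (φ T) p q := fun S T hST h =>
    conn_prod_mono hdr hds hrs hT hsep hD hK hB hR h𝔉K h𝔉r h𝔉s h𝔉cl h𝔉d h𝔉pk S hST h
  have hpair : ∀ S : Finset ({C // C ∈ 𝔉} ⊕ {e // e ∈ R}), Conn ends (φ Sᶜ) p q →
      Conn ends (OneColourSwitch.compl (φ S)) p q := fun S h =>
    conn_compl_prod_of_conn_compl hdr hds hrs hT hsep hD hK hB hR h𝔉K h𝔉r h𝔉s h𝔉cl h𝔉d h𝔉pk
      hdisj S h
  have hHanti : Antitone H := by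
    intro S S' hSS
    simp only [hH]
    by_cases h' : WDefect ends p q r s d (φ S')
    · rw [if_pos h', if_pos (wdefect_prod_anti hdr hds hrs hT hsep hD hK hB hR h𝔉K h𝔉r h𝔉s
        h𝔉cl h𝔉d h𝔉pk hSS h')]
    · rw [if_neg h']
      split_ifs <;> linarith
  have hH0 : ∀ S, 0 ≤ H S := by
    intro S
    simp only [hH]
    split_ifs <;> linarith
  have key := sum_cube_weight_mul_sigma_pq_nonpos φ hY hpair H hHanti hH0
  refine le_trans (le_of_eq (Finset.sum_congr rfl fun S _ => ?_)) key
  have hrsS : sigma ends (φ S) r s = sigma ends ρ r s :=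
    sigma_rs_prod_eq hdr hds hrs hT hsep hD hK hB hR h𝔉K h𝔉r h𝔉s h𝔉cl h𝔉d h𝔉pk h𝔉nl S
  by_cases h' : WDefect ends p q r s d (φ S)
  · rw [if_pos h']
    simp only [hH, if_pos h']
    rw [hrsS]; ring
  · rw [if_neg h']
    simp only [hH, if_neg h']
    ring

/-- Every index lies in the cube (stated here so that the cube carries the `Fintype` instance of
`sum_prod_fibre_HD_nonpos`). -/
lemma mem_univ_index (S : Finset ({C // C ∈ 𝔉} ⊕ {e // e ∈ R})) :
    S ∈ (univ : Finset (Finset ({C // C ∈ 𝔉} ⊕ {e // e ∈ R}))) :=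
  Finset.mem_univ S

end NoPocket

end Summit.Ventures.PercRepro2
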